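import Summits.ValiantsHypothesis.ValiantsHypothesis.Theses.RyserTripartition

/-!
# ValiantsHypothesis / RyserTripartition — item `RyserToMultilinear` (stmt-ValiantsHypothesis-7165), closed

`RyserOptimal → MultilinearRyserOptimal`: a fan-in-two syntactically multilinear circuit computing
`per_n` is in particular a fan-in-two circuit computing `per_n`, so `complexity per_n ≤ P.size`
(`Nat.sInf_le` on the defining set of `complexity`); hence Ryser-optimality of general circuits gives
Ryser-optimality of multilinear ones. HONEST FRAMING: bookkeeping; `RyserOptimal` is an OPEN crux;
nothing here is progress on `VP ≠ VNP`.
-/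

-- layout Summits/ValiantsHypothesis/ValiantsHypothesis forces the duplicated namespace component
set_option linter.dupNamespace false

namespace Summit.ValiantsHypothesis.ValiantsHypothesis.Theorems.RyserTripartition

open Literature.Computability.AlgebraicComplexity

/-- **Item `RyserToMultilinear` (stmt-ValiantsHypothesis-7165):** `RyserOptimal → MultilinearRyserOptimal`.
[folklore] -/
theorem ryserToMultilinear_proof : Theses.RyserTripartition.RyserToMultilinear := by
  unfold Theses.RyserTripartition.RyserToMultilinear Theses.RyserTripartition.RyserOptimal
    Theses.RyserTripartition.MultilinearRyserOptimal
  intro h ε hε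
  obtain ⟨n₀, hn₀⟩ := h ε hε
  refine ⟨n₀, fun n hn P hP => (hn₀ n hn).trans ?_⟩
  have hle : complexity (perPoly (Fin n) ℂ) ≤ P.size :=
    Nat.sInf_le ⟨P, hP.1, hP.2.2, rfl⟩
  exact_mod_cast hle

end Summit.ValiantsHypothesis.ValiantsHypothesis.Theorems.RyserTripartition
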